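import Summits.SmoothPoincare4.SmoothPoincare4.Theorems.ConvexBisectionAcyclicBisectionExistsBeltMonodromySeamLift
import Summits.SmoothPoincare4.SmoothPoincare4.Theorems.ConvexBisectionAcyclicBisectionExistsBeltMonodromyPages
import HarnessLib

/-!
# N1-mono ▸ piece (d10)-prep: THE CHART FAMILY IS AN OPEN MAP INTO THE BOUNDARY 3-MANIFOLD
(wave 8, brick of stub `stub_M2geo` = node N1 ▸ `piece_d` = `helper_N1_beltMonodromy`, line `modp-braid-orbits`,
crux `ConvexBisection.AcyclicBisectionExists`, item stmt-SmoothPoincare4-10508; worker J3, lead c5; registered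
sub-goal `helper_chartFamily_coversDeepTube`)

The local-inverse plumbing every remaining piece of (d) needs ((d5′) pushed field, (d8) smooth raw coordinates,
(d10) flow-region bookkeeping: H4-REPORT §4, J3-REPORT §3 (R0)): a `C^∞` map `f : ℝ³ → N` into a `3`-manifold
(model `𝓡 3`) with INJECTIVE differential at `p` maps neighbourhoods of `p` ONTO neighbourhoods of `f p`
(`map f (𝓝 p) = 𝓝 (f p)`; inverse function theorem in the chart at `f p`: injective `ℝ³ → ℝ³` is onto), hence the
image of an open set on which this holds is OPEN (§1).  Applied (§2) to the lift `(bBase g).inclInv ∘ φ` of the input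
chart family `φ` of (d) — smooth and immersive on the open box by H4-6/H4-8 — : the box `ℝ × (−1,1) × (−η₁, η₁)`, and
every open part of it, has OPEN image in the boundary `3`-manifold `(bBase g).carrier` of the base; read back in
`Base g`: an open set of `Base g` meeting `∂ Base g` exactly in the image (`chartFamily_isOpen_image`).  §3 draws the
consequence the flow-region bookkeeping of the glued chart consumes (COVER-RAW, IMAGE-RAW of
`J3Interface.FlowChartStatement`; J1's smallness converse): registered `helper_chartFamily_coversDeepTube` — a uniform
`δ > 0` such that every point of the boundary tube of `h k` at fibre radius `< δ` in the page of a level `|σ| < π` is a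
chart point `φ (u, r, σ)` OF THAT LEVEL with `|r| < r₀` (tube lemma around the compact core circle in tube
coordinates + distinct pages are disjoint).  §4 (appended): an injective immersion of an OPEN set of `ℝ³` into a
`3`-manifold IS an open partial homeomorphism (`ChartOpen.exists_openPartialHomeomorph_eq`) whose inverse is `C^∞` on
the (open) image (`ChartOpen.contMDiffOn_symm_of_injective_mfderiv`) — a DIFFEOMORPHISM onto an open set; this is the
smooth-local-inverse tool for the raw coordinate map `G₁` of the glued chart and for J1's pushed field (d5′).
Reference: J. M. Lee, *Introduction to Smooth Manifolds* (2013), Thm. 4.5 (inverse function theorem for manifolds)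
[LeeSmoothManifolds2013].
-/

noncomputable section

set_option linter.dupNamespace false

open scoped Manifold ContDiff Topology
open Set Function Filter
open Literature.Topology.FourManifolds Literature.Topology.FourManifolds.HandleAttachingMap
  Literature.Topology.FourManifolds.LefschetzBase

namespace Summit.SmoothPoincare4.SmoothPoincare4.Theorems.AcyclicBisectionExists.ModpBraidOrbits

namespace ChartOpen

/-! ## §1 Injective differential in dimension three: neighbourhoods onto neighbourhoods -/

/-- `ℝ × ℝ × ℝ` and `EuclideanSpace ℝ (Fin 3)` have the same dimension. [folklore] -/
theorem finrank_prod_three : Module.finrank ℝ (ℝ × ℝ × ℝ) = Module.finrank ℝ (EuclideanSpace ℝ (Fin 3)) := by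
  simp

/-- **Inverse function theorem, open-mapping form, for maps `ℝ³ → N³`.**  A map into a `3`-manifold which is
`C^n` (`n ≠ 0`) at `p` with injective differential at `p` maps the neighbourhood filter of `p` onto that of `f p`.
[cite: LeeSmoothManifolds2013, Thm. 4.5] -/
theorem map_nhds_eq_of_injective_mfderiv {N : Type*} [TopologicalSpace N]
    [ChartedSpace (EuclideanSpace ℝ (Fin 3)) N] [IsManifold (𝓡 3) ∞ N] {f : ℝ × ℝ × ℝ → N} {p : ℝ × ℝ × ℝ}
    (hf : ContMDiffAt 𝓘(ℝ, ℝ × ℝ × ℝ) (𝓡 3) ∞ f p)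
    (hinj : Injective (mfderiv 𝓘(ℝ, ℝ × ℝ × ℝ) (𝓡 3) f p)) : map f (𝓝 p) = 𝓝 (f p) := by
  set c := extChartAt (𝓡 3) (f p) with hc
  have hps : f p ∈ c.source := mem_extChartAt_source (f p)
  -- `c ∘ f` is smooth at `p` as a map of vector spaces, with injective — hence onto — derivative
  have hcf : ContMDiffAt 𝓘(ℝ, ℝ × ℝ × ℝ) 𝓘(ℝ, EuclideanSpace ℝ (Fin 3)) ∞ (c ∘ f) p :=
    (contMDiffAt_extChartAt (I := 𝓡 3) (x := f p)).comp p hf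
  have hcf' : ContDiffAt ℝ ∞ (c ∘ f) p := hcf.contDiffAt
  have hfd : MDifferentiableAt 𝓘(ℝ, ℝ × ℝ × ℝ) (𝓡 3) f p := hf.mdifferentiableAt (by simp)
  have hcd : MDifferentiableAt (𝓡 3) 𝓘(ℝ, EuclideanSpace ℝ (Fin 3)) c (f p) :=
    (contMDiffAt_extChartAt (I := 𝓡 3) (x := f p) (n := ∞)).mdifferentiableAt (by simp)
  have hcomp := mfderiv_comp p hcd hfd
  have hinj' : Injective (fderiv ℝ (c ∘ f) p) := by
    rw [← mfderiv_eq_fderiv, hcomp]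
    obtain ⟨A, hA⟩ := isInvertible_mfderiv_extChartAt (I := 𝓡 3) hps
    intro v v' hvv
    apply hinj
    apply A.injective
    have e : ∀ w, A w = mfderiv (𝓡 3) 𝓘(ℝ, EuclideanSpace ℝ (Fin 3)) c (f p) w := fun w => by
      rw [← hA]; rfl
    rw [e, e]
    exact hvv
  have hsurj : (fderiv ℝ (c ∘ f) p).range = ⊤ := by
    rw [LinearMap.range_eq_top]
    exact (LinearMap.injective_iff_surjective_of_finrank_eq_finrank finrank_prod_three).1 hinj'
  have hstrict := hcf'.hasStrictFDerivAt (by simp)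
  have hmap : map (c ∘ f) (𝓝 p) = 𝓝 (c (f p)) := hstrict.map_nhds_eq_of_surj hsurj
  -- `f = c.symm ∘ (c ∘ f)` near `p`
  have hev : f =ᶠ[𝓝 p] (c.symm ∘ (c ∘ f)) := by
    have h1 : ∀ᶠ q in 𝓝 p, f q ∈ c.source :=
      hf.continuousAt.preimage_mem_nhds (extChartAt_source_mem_nhds (I := 𝓡 3) (f p))
    filter_upwards [h1] with q hq using (c.left_inv hq).symm
  have hsymm := map_extChartAt_symm_nhdsWithin_range (I := 𝓡 3) (f p)
  rw [ModelWithCorners.range_eq_univ, nhdsWithin_univ] at hsymm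
  calc map f (𝓝 p) = map (c.symm ∘ (c ∘ f)) (𝓝 p) := Filter.map_congr hev
    _ = map c.symm (map (c ∘ f) (𝓝 p)) := Filter.map_map.symm
    _ = map c.symm (𝓝 (c (f p))) := by rw [hmap]
    _ = 𝓝 (f p) := hsymm

/-- **Image of an open set is open** where the differential is injective throughout. [cite: LeeSmoothManifolds2013, Thm. 4.5] -/
theorem isOpen_image_of_injective_mfderiv {N : Type*} [TopologicalSpace N]
    [ChartedSpace (EuclideanSpace ℝ (Fin 3)) N] [IsManifold (𝓡 3) ∞ N] {f : ℝ × ℝ × ℝ → N} {U : Set (ℝ × ℝ × ℝ)}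
    (hU : IsOpen U) (hf : ∀ p ∈ U, ContMDiffAt 𝓘(ℝ, ℝ × ℝ × ℝ) (𝓡 3) ∞ f p)
    (hinj : ∀ p ∈ U, Injective (mfderiv 𝓘(ℝ, ℝ × ℝ × ℝ) (𝓡 3) f p)) : IsOpen (f '' U) := by
  rw [isOpen_iff_mem_nhds]
  rintro y ⟨p, hp, rfl⟩
  rw [← map_nhds_eq_of_injective_mfderiv (hf p hp) (hinj p hp)]
  exact image_mem_map (hU.mem_nhds hp)

end ChartOpen

open ChartOpen

/-! ## §2 The lift of the chart family to the boundary `3`-manifold is open -/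

section Family

variable {g : ℕ} [Nonempty (bBase g).carrier]

/-- The lift `(bBase g).inclInv ∘ φ` of the chart family is smooth with injective differential at every point of
the open box (H4-6 `chartFamily_fderiv_injective`, H4-8 `injective_mfderiv_inclInv_comp`). [cite: LeeSmoothManifolds2013, Thm. 4.5] -/
theorem chartFamilyLift_contMDiffAt_injective {c : ℂ} (hc : ‖c‖ = 1) {η₁ : ℝ} {φ : ℝ × ℝ × ℝ → Base g}
    (hφs : ContMDiff 𝓘(ℝ, ℝ × ℝ × ℝ) (𝓡∂ 4) ∞ φ)
    (hφp : ∀ u r σ, σ ∈ Icc (-η₁) η₁ → φ (u, r, σ) ∈ page g (c * Complex.exp ((σ : ℂ) * Complex.I)))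
    {p : ℝ × ℝ × ℝ} (hσ : p.2.2 ∈ Ioo (-η₁) η₁)
    (hφo : 0 < inner ℝ (deriv (fun r' => (φ (p.1, r', p.2.2)).1) p.2.1)
      (cplxJ (deriv (fun u' => (φ (u', p.2.1, p.2.2)).1) p.1))) :
    ContMDiffAt 𝓘(ℝ, ℝ × ℝ × ℝ) (𝓡 3) ∞ (fun p' => (bBase g).inclInv (φ p')) p ∧
      Injective (mfderiv 𝓘(ℝ, ℝ × ℝ × ℝ) (𝓡 3) (fun p' => (bBase g).inclInv (φ p')) p) := by
  set U : Set (ℝ × ℝ × ℝ) := {p' | p'.2.2 ∈ Ioo (-η₁) η₁} with hU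
  have hUo : IsOpen U := isOpen_Ioo.preimage (continuous_snd.comp continuous_snd)
  have hpU : p ∈ U := hσ
  have hc' : ∀ σ : ℝ, ‖c * Complex.exp ((σ : ℂ) * Complex.I)‖ = 1 := fun σ => by
    rw [norm_mul, hc, Complex.norm_exp_ofReal_mul_I, mul_one]
  have hbdry : ∀ p' ∈ U, φ p' ∈ range (bBase g).incl := fun p' hp' => by
    rw [(bBase g).range_incl]
    exact page_subset_boundary g (hc' p'.2.2) (hφp p'.1 p'.2.1 p'.2.2 ⟨hp'.1.le, hp'.2.le⟩)
  refine ⟨((bBase g).contMDiffOn_inclInv.comp hφs.contMDiffOn hbdry).contMDiffAt (hUo.mem_nhds hpU), ?_⟩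
  have hF : Injective (fderiv ℝ (fun p' : ℝ × ℝ × ℝ => (φ p').1) p) :=
    chartFamily_fderiv_injective (u := p.1) (r := p.2.1) (σ := p.2.2) hc hφs hφp hσ hφo
  exact injective_mfderiv_inclInv_comp hφs hUo hpU hbdry (injective_mfderiv_of_injective_fderiv_val hφs hF)

/-- The lift of the chart family, read back in the base, is the chart family (on the box). [folklore] -/
theorem incl_chartFamilyLift {c : ℂ} (hc : ‖c‖ = 1) {η₁ : ℝ} {φ : ℝ × ℝ × ℝ → Base g}
    (hφp : ∀ u r σ, σ ∈ Icc (-η₁) η₁ → φ (u, r, σ) ∈ page g (c * Complex.exp ((σ : ℂ) * Complex.I)))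
    {p : ℝ × ℝ × ℝ} (hσ : p.2.2 ∈ Icc (-η₁) η₁) : (bBase g).incl ((bBase g).inclInv (φ p)) = φ p := by
  have hc' : ‖c * Complex.exp ((p.2.2 : ℂ) * Complex.I)‖ = 1 := by
    rw [norm_mul, hc, Complex.norm_exp_ofReal_mul_I, mul_one]
  exact (bBase g).incl_inclInv (page_subset_boundary g hc' (hφp p.1 p.2.1 p.2.2 hσ))

end Family

/-- **`chartFamily_isOpen_image` — THE CHART FAMILY OF (d) IS OPEN INTO THE BOUNDARY `3`-MANIFOLD.**
For the input chart family `φ` of `N1MonoStatement` (smooth, level `σ ⊂ page g (c e^{iσ})` for `|σ| ≤ η₁`, positively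
oriented at every `(u, r)` with `|r| < 1`, `|σ| ≤ η₁`) and every open `U` inside the open box `ℝ × (−1,1) × (−η₁, η₁)`:
the lift `(bBase g).inclInv ∘ φ` maps `U` onto an OPEN subset of `(bBase g).carrier`, and there is an open set `O` of
`Base g` with `O ∩ ∂ Base g = φ '' U` — the chart family sweeps out an open piece of the boundary near the core.
[cite: LeeSmoothManifolds2013, Thm. 4.5] -/
theorem chartFamily_isOpen_image : ∀ (g : ℕ) [Nonempty (Literature.Topology.FourManifolds.LefschetzBase.bBase g).carrier] (c : ℂ) (η₁ : ℝ) (φ : ℝ × ℝ × ℝ → Literature.Topology.FourManifolds.LefschetzBase.Base g), ‖c‖ = 1 → ContMDiff 𝓘(ℝ, ℝ × ℝ × ℝ) (𝓡∂ 4) ∞ φ → (∀ u r σ, σ ∈ Set.Icc (-η₁) η₁ → φ (u, r, σ) ∈ Literature.Topology.FourManifolds.LefschetzBase.page g (c * Complex.exp ((σ : ℂ) * Complex.I))) → (∀ u r σ, r ∈ Set.Ioo (-1 : ℝ) 1 → σ ∈ Set.Icc (-η₁) η₁ → 0 < inner ℝ (deriv (fun r' => (φ (u, r', σ)).1) r)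 (Literature.Topology.FourManifolds.LefschetzBase.cplxJ (deriv (fun u' => (φ (u', r, σ)).1) u))) → ∀ U : Set (ℝ × ℝ × ℝ), IsOpen U → U ⊆ Set.univ ×ˢ (Set.Ioo (-1 : ℝ) 1 ×ˢ Set.Ioo (-η₁) η₁) → IsOpen ((fun p : ℝ × ℝ × ℝ => (Literature.Topology.FourManifolds.LefschetzBase.bBase g).inclInv (φ p)) '' U) ∧ ∃ O : Set (Literature.Topology.FourManifolds.LefschetzBase.Base g), IsOpen O ∧ O ∩ (𝓡∂ 4).boundary (Literature.Topology.FourManifolds.LefschetzBase.Base g) = φ '' U := by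
  intro g _ c η₁ φ hc hφs hφp hφo U hUo hUsub
  have key : ∀ p ∈ U, ContMDiffAt 𝓘(ℝ, ℝ × ℝ × ℝ) (𝓡 3) ∞ (fun p' => (bBase g).inclInv (φ p')) p ∧
      Injective (mfderiv 𝓘(ℝ, ℝ × ℝ × ℝ) (𝓡 3) (fun p' => (bBase g).inclInv (φ p')) p) := by
    intro p hp
    obtain ⟨-, hr, hσ⟩ := hUsub hp
    exact chartFamilyLift_contMDiffAt_injective hc hφs hφp hσ (hφo p.1 p.2.1 p.2.2 hr ⟨hσ.1.le, hσ.2.le⟩)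
  have hopen : IsOpen ((fun p : ℝ × ℝ × ℝ => (bBase g).inclInv (φ p)) '' U) :=
    isOpen_image_of_injective_mfderiv hUo (fun p hp => (key p hp).1) (fun p hp => (key p hp).2)
  refine ⟨hopen, ?_⟩
  -- the inclusion of the boundary datum is an embedding onto `∂ Base g`: open sets are traces of open sets
  obtain ⟨O, hO, hOeq⟩ := (bBase g).isSmoothEmbedding.isEmbedding.isInducing.isOpen_iff.1 hopen
  refine ⟨O, hO, ?_⟩
  have himg : (bBase g).incl '' ((fun p : ℝ × ℝ × ℝ => (bBase g).inclInv (φ p)) '' U) = φ '' U := by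
    rw [Set.image_image]
    refine Set.image_congr fun p hp => ?_
    obtain ⟨-, -, hσ⟩ := hUsub hp
    exact incl_chartFamilyLift hc hφp ⟨hσ.1.le, hσ.2.le⟩
  rw [← himg, ← hOeq, Set.image_preimage_eq_inter_range, (bBase g).range_incl, Set.inter_comm]

/-! ## §3 The chart family covers a uniform deep tube around the core, level by level -/

/-- **Pages near the belt direction determine their level**: a point in the pages of directions `d_k e^{iσ}` and
`d_k e^{iσ'}` (`|σ|, |σ'| < π`) forces `σ = σ'`. [folklore] -/
theorem level_eq_of_mem_page {g : ℕ} {dk : ℂ} (hdk : ‖dk‖ = 1) {σ σ' : ℝ} (hσ : |σ| < Real.pi)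
    (hσ' : |σ'| < Real.pi) {a : Base g} (ha : a ∈ page g (dk * Complex.exp ((σ : ℂ) * Complex.I)))
    (ha' : a ∈ page g (dk * Complex.exp ((σ' : ℂ) * Complex.I))) : σ = σ' := by
  by_contra hne
  have hne' : dk * Complex.exp ((σ : ℂ) * Complex.I) ≠ dk * Complex.exp ((σ' : ℂ) * Complex.I) := by
    intro he
    have hdk0 : dk ≠ 0 := norm_ne_zero_iff.1 (by rw [hdk]; norm_num)
    have h2 : Complex.exp ((σ : ℂ) * Complex.I) = Complex.exp ((σ' : ℂ) * Complex.I) :=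
      mul_left_cancel₀ hdk0 he
    have h3 : Complex.exp (((σ - σ' : ℝ) : ℂ) * Complex.I) = 1 := by
      rw [show ((σ - σ' : ℝ) : ℂ) * Complex.I = (σ : ℂ) * Complex.I - (σ' : ℂ) * Complex.I by
        push_cast; ring, Complex.exp_sub, h2, div_self (Complex.exp_ne_zero _)]
    have hlt : |σ - σ'| < 2 * Real.pi := by
      have := abs_sub σ σ'
      linarith
    exact exp_ofReal_mul_I_ne_one (sub_ne_zero.2 hne) hlt h3
  exact Set.disjoint_left.1 (disjoint_page g hne') ha ha'

/-- **Sub-goal `helper_chartFamily_coversDeepTube` — THE CHART FAMILY OF (d) COVERS A UNIFORM DEEP TUBE AROUND THE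
CORE, LEVEL BY LEVEL** (the geometric input of the flow-region bookkeeping COVER-RAW / IMAGE-RAW of the glued chart,
J3-REPORT §3 (R0)).  For the input chart family `φ` of `N1MonoStatement` with core `γ_k` (smooth, `1`-periodic core
clause, level `σ ⊂ page g (d k e^{iσ})` for `|σ| ≤ η₁`, oriented) and any `0 < η' < min η₁ π`, `0 < r₀ ≤ 1`: there is
`δ > 0` such that every point of the boundary tube of `h k` at fibre radius `< δ` which lies in the page of a level
`|σ| < π` is a chart point `φ (u, r, σ)` of THAT level with `|r| < r₀` (and then `|σ| < η'`).
[cite: LeeSmoothManifolds2013, Thm. 4.5] -/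
theorem helper_chartFamily_coversDeepTube : ∀ (g n : ℕ) [Nonempty (Literature.Topology.FourManifolds.LefschetzBase.bBase g).carrier] (h : Fin n → Literature.Topology.FourManifolds.HandleAttachingMap 3 2 (Literature.Topology.FourManifolds.LefschetzBase.Base g)) (d : Fin n → ℂ) (k : Fin n) (η₁ η' r₀ : ℝ) (φ : ℝ × ℝ × ℝ → Literature.Topology.FourManifolds.LefschetzBase.Base g), ‖d k‖ = 1 → ContMDiff 𝓘(ℝ, ℝ × ℝ × ℝ) (𝓡∂ 4) ∞ φ → (∀ u, φ (u, 0, 0) = (h k).attachingCircle (Literature.Topology.FourManifolds.circlePt u)) → (∀ u r σ, σ ∈ Set.Icc (-η₁) η₁ → φ (u, r, σ) ∈ Literature.Topology.FourManifolds.LefschetzBase.page g (d k * Complex.exp ((σ : ℂ) * Complex.I))) → (∀ u r σ, r ∈ Set.Ioo (-1 : ℝ) 1 → σ ∈ Set.Icc (-η₁) η₁ → 0 < inner ℝ (deriv (fun r' => (φ (u, r', σ)).1) r) (Literature.Topology.FourManifolds.LefschetzBase.cplxJ (deriv (fun u' => (φ (u', r, σ)).1) u))) → 0 < η' → η' < η₁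 → η' < Real.pi → 0 < r₀ → r₀ ≤ 1 → ∃ δ : ℝ, 0 < δ ∧ ∀ (θ : Metric.sphere (0 : EuclideanSpace ℝ (Fin 2)) 1) (v : EuclideanSpace ℝ (Fin 2)), ‖v‖ < δ → ∀ σ : ℝ, |σ| < Real.pi → (((h k).boundaryTube.toHomeo (θ, v) : ↥((𝓡∂ 4).boundary (Literature.Topology.FourManifolds.LefschetzBase.Base g))) : Literature.Topology.FourManifolds.LefschetzBase.Base g) ∈ Literature.Topology.FourManifolds.LefschetzBase.page g (d k * Complex.exp ((σ : ℂ) * Complex.I)) → ∃ u r : ℝ, r ∈ Set.Ioo (-r₀) r₀ ∧ |σ| < η' ∧ φ (u, r, σ) = (((h k).boundaryTube.toHomeo (θ, v) : ↥((𝓡∂ 4).boundary (Literature.Topology.FourManifolds.LefschetzBase.Base g))) : Literature.Topology.FourManifolds.LefschetzBase.Base g) := by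
  intro g n _ h d k η₁ η' r₀ φ hd hφs hφcore hφp hφo hη' hη'η₁ hη'π hr₀ hr₀1
  -- the open box and its open image
  set U : Set (ℝ × ℝ × ℝ) := Set.univ ×ˢ (Set.Ioo (-r₀) r₀ ×ˢ Set.Ioo (-η') η') with hU
  have hUo : IsOpen U := isOpen_univ.prod (isOpen_Ioo.prod isOpen_Ioo)
  have hUsub : U ⊆ Set.univ ×ˢ (Set.Ioo (-1 : ℝ) 1 ×ˢ Set.Ioo (-η₁) η₁) := by
    rintro ⟨u, r, σ⟩ ⟨-, hr, hσ⟩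
    exact ⟨mem_univ _, ⟨by linarith [hr.1], by linarith [hr.2]⟩, ⟨by linarith [hσ.1], by linarith [hσ.2]⟩⟩
  obtain ⟨-, O, hO, hOeq⟩ := chartFamily_isOpen_image g (d k) η₁ φ hd hφs hφp hφo U hUo hUsub
  -- the tube map read in the base
  set T : Metric.sphere (0 : EuclideanSpace ℝ (Fin 2)) 1 × EuclideanSpace ℝ (Fin 2) → Base g :=
    fun q => (((h k).boundaryTube.toHomeo q : ↥((𝓡∂ 4).boundary (Base g))) : Base g) with hT
  have hTc : ContinuousOn T (h k).boundaryTube.toHomeo.source :=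
    continuous_subtype_val.comp_continuousOn (h k).boundaryTube.toHomeo.continuousOn
  have hsrc : (h k).boundaryTube.toHomeo.source =
      (Set.univ : Set (Metric.sphere (0 : EuclideanSpace ℝ (Fin 2)) 1)) ×ˢ Metric.ball (0 : EuclideanSpace ℝ (Fin 2)) 1 :=
    (h k).boundaryTube.source_eq
  set V : Set (Metric.sphere (0 : EuclideanSpace ℝ (Fin 2)) 1 × EuclideanSpace ℝ (Fin 2)) :=
    (h k).boundaryTube.toHomeo.source ∩ T ⁻¹' O with hV
  have hVo : IsOpen V := hTc.isOpen_inter_preimage (h k).boundaryTube.toHomeo.open_source hO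
  -- the core circle lies in `V`
  have hcoreV : (Set.univ : Set (Metric.sphere (0 : EuclideanSpace ℝ (Fin 2)) 1)) ×ˢ
      ({0} : Set (EuclideanSpace ℝ (Fin 2))) ⊆ V := by
    rintro ⟨θ, v⟩ ⟨-, hv⟩
    rw [Set.mem_singleton_iff] at hv
    subst hv
    refine ⟨(h k).boundaryTube.mem_source_zero θ, ?_⟩
    show T (θ, 0) ∈ O
    have hTθ : T (θ, 0) = (h k).attachingCircle θ := by
      simp only [hT]
      rw [HandleAttachingMap.coe_boundaryTube_apply, depthLine_zero_zero]
      rfl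
    have hmem : (h k).attachingCircle θ ∈ φ '' U := by
      refine ⟨(angA θ, 0, 0), ⟨mem_univ _, ⟨by linarith, hr₀⟩, ⟨by linarith, hη'⟩⟩, ?_⟩
      rw [hφcore, circlePt_angA]
    rw [hTθ]
    rw [← hOeq] at hmem
    exact hmem.1
  obtain ⟨A, B, hA, hB, hAu, hB0, hAB⟩ :=
    generalized_tube_lemma isCompact_univ isCompact_singleton hVo hcoreV
  obtain ⟨δ, hδ, hδB⟩ := Metric.isOpen_iff.1 hB 0 (hB0 rfl)
  refine ⟨δ, hδ, fun θ v hv σ hσπ hpage => ?_⟩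
  have hθv : (θ, v) ∈ V := hAB ⟨hAu (mem_univ θ), hδB (mem_ball_zero_iff.2 hv)⟩
  have hTO : T (θ, v) ∈ O := hθv.2
  have hTb : T (θ, v) ∈ (𝓡∂ 4).boundary (Base g) := ((h k).boundaryTube.toHomeo (θ, v)).2
  have hTim : T (θ, v) ∈ φ '' U := by rw [← hOeq]; exact ⟨hTO, hTb⟩
  obtain ⟨⟨u, r, σ'⟩, ⟨-, hr, hσ'⟩, hφq⟩ := hTim
  have hσ'1 : σ' ∈ Set.Icc (-η₁) η₁ := ⟨by linarith [hσ'.1], by linarith [hσ'.2]⟩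
  have hlev : σ' = σ :=
    level_eq_of_mem_page (hd) ((abs_lt.2 ⟨hσ'.1, hσ'.2⟩).trans hη'π) hσπ (hφp u r σ' hσ'1) (hφq ▸ hpage)
  subst hlev
  exact ⟨u, r, hr, abs_lt.2 ⟨hσ'.1, hσ'.2⟩, hφq⟩

/-! ## §4 Injective immersions of open sets of `ℝ³` into `3`-manifolds: diffeomorphisms onto open sets -/

namespace ChartOpen

variable {N : Type*} [TopologicalSpace N] [ChartedSpace (EuclideanSpace ℝ (Fin 3)) N] [IsManifold (𝓡 3) ∞ N]

/-- **An injective immersion of an open set of `ℝ³` into a `3`-manifold is a homeomorphism onto an open set**: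
it IS an open partial homeomorphism `e` (`⇑e = f`, `e.source = V`, `e.target = f '' V`).
[cite: LeeSmoothManifolds2013, Thm. 4.5] -/
theorem exists_openPartialHomeomorph_eq {f : ℝ × ℝ × ℝ → N} {V : Set (ℝ × ℝ × ℝ)} (hV : IsOpen V)
    (hf : ∀ p ∈ V, ContMDiffAt 𝓘(ℝ, ℝ × ℝ × ℝ) (𝓡 3) ∞ f p)
    (hinj' : ∀ p ∈ V, Injective (mfderiv 𝓘(ℝ, ℝ × ℝ × ℝ) (𝓡 3) f p)) (hinj : InjOn f V) :
    ∃ e : OpenPartialHomeomorph (ℝ × ℝ × ℝ) N, ⇑e = f ∧ e.source = V ∧ e.target = f '' V := by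
  classical
  have hopen : ∀ W : Set (ℝ × ℝ × ℝ), IsOpen W → W ⊆ V → IsOpen (f '' W) := fun W hW hWV =>
    isOpen_image_of_injective_mfderiv hW (fun p hp => hf p (hWV hp)) (fun p hp => hinj' p (hWV hp))
  have hcont : ContinuousOn f V := fun p hp => (hf p hp).continuousAt.continuousWithinAt
  have hleft : ∀ q ∈ V, invFunOn f V (f q) = q := fun q hq => hinj.leftInvOn_invFunOn hq
  have hinv : ContinuousOn (invFunOn f V) (f '' V) := by
    rw [continuousOn_iff]
    rintro y ⟨p, hp, rfl⟩ W hW hpW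
    rw [hleft p hp] at hpW
    refine ⟨f '' (W ∩ V), hopen _ (hW.inter hV) inter_subset_right, ⟨p, ⟨hpW, hp⟩, rfl⟩, ?_⟩
    rintro y' ⟨⟨q, ⟨hqW, hqV⟩, rfl⟩, -⟩
    show invFunOn f V (f q) ∈ W
    rw [hleft q hqV]
    exact hqW
  exact ⟨{ toFun := f, invFun := invFunOn f V, source := V, target := f '' V,
           map_source' := fun p hp => mem_image_of_mem f hp,
           map_target' := fun y hy => hinj.bijOn_image.surjOn.mapsTo_invFunOn hy,
           left_inv' := fun p hp => hleft p hp,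
           right_inv' := fun y hy => hinj.bijOn_image.invOn_invFunOn.2 hy,
           open_source := hV, open_target := hopen V hV subset_rfl,
           continuousOn_toFun := hcont, continuousOn_invFun := hinv }, rfl, rfl, rfl⟩

/-- **… and its inverse is smooth**: for an open partial homeomorphism `e : ℝ³ ⇀ N` which is `C^∞` with injective
differential on its source, `e.symm` is `C^∞` on `e.target` — `e` is a diffeomorphism of `e.source` onto the open
set `e.target` (inverse function theorem in the chart at the image point). [cite: LeeSmoothManifolds2013, Thm. 4.5] -/
theorem contMDiffOn_symm_of_injective_mfderiv (e : OpenPartialHomeomorph (ℝ × ℝ × ℝ) N)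
    (hf : ∀ p ∈ e.source, ContMDiffAt 𝓘(ℝ, ℝ × ℝ × ℝ) (𝓡 3) ∞ e p)
    (hinj' : ∀ p ∈ e.source, Injective (mfderiv 𝓘(ℝ, ℝ × ℝ × ℝ) (𝓡 3) e p)) :
    ContMDiffOn (𝓡 3) 𝓘(ℝ, ℝ × ℝ × ℝ) ∞ e.symm e.target := by
  intro y hy
  apply ContMDiffAt.contMDiffWithinAt
  set p := e.symm y with hp_def
  have hp : p ∈ e.source := e.map_target hy
  have hyp : e p = y := e.right_inv hy
  set c := extChartAt (𝓡 3) (e p) with hc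
  have hps : e p ∈ c.source := mem_extChartAt_source (e p)
  -- `G := c ∘ e` near `p`: smooth with bijective derivative
  have hG : ContDiffAt ℝ ∞ (c ∘ e) p :=
    ((contMDiffAt_extChartAt (I := 𝓡 3) (x := e p)).comp p (hf p hp)).contDiffAt
  have hfd : MDifferentiableAt 𝓘(ℝ, ℝ × ℝ × ℝ) (𝓡 3) e p := (hf p hp).mdifferentiableAt (by simp)
  have hcd : MDifferentiableAt (𝓡 3) 𝓘(ℝ, EuclideanSpace ℝ (Fin 3)) c (e p) :=
    (contMDiffAt_extChartAt (I := 𝓡 3) (x := e p) (n := ∞)).mdifferentiableAt (by simp)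
  have hcomp := mfderiv_comp p hcd hfd
  have hinjG : Injective (fderiv ℝ (c ∘ e) p) := by
    rw [← mfderiv_eq_fderiv, hcomp]
    obtain ⟨A, hA⟩ := isInvertible_mfderiv_extChartAt (I := 𝓡 3) hps
    intro v v' hvv
    apply hinj' p hp
    apply A.injective
    have e1 : ∀ w, A w = mfderiv (𝓡 3) 𝓘(ℝ, EuclideanSpace ℝ (Fin 3)) c (e p) w := fun w => by
      rw [← hA]; rfl
    rw [e1, e1]
    exact hvv
  have hker : (fderiv ℝ (c ∘ e) p).ker = ⊥ := LinearMap.ker_eq_bot.2 hinjG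
  have hrange : (fderiv ℝ (c ∘ e) p).range = ⊤ := LinearMap.range_eq_top.2
    ((LinearMap.injective_iff_surjective_of_finrank_eq_finrank finrank_prod_three).1 hinjG)
  set L : (ℝ × ℝ × ℝ) ≃L[ℝ] EuclideanSpace ℝ (Fin 3) :=
    ContinuousLinearEquiv.ofBijective (fderiv ℝ (c ∘ e) p) hker hrange with hL
  have hLd : HasFDerivAt (c ∘ e) (L : (ℝ × ℝ × ℝ) →L[ℝ] EuclideanSpace ℝ (Fin 3)) p := by
    rw [hL, ContinuousLinearEquiv.coe_ofBijective]
    exact (hG.differentiableAt (by simp)).hasFDerivAt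
  have hS : HasStrictFDerivAt (c ∘ e) (L : (ℝ × ℝ × ℝ) →L[ℝ] EuclideanSpace ℝ (Fin 3)) p :=
    hG.hasStrictFDerivAt' hLd (by simp)
  -- the smooth local inverse of `G` IS `e.symm ∘ c.symm` near `G p`
  have h1 : ContDiffAt ℝ ∞ (hG.localInverse hLd (by simp)) ((c ∘ e) p) := hG.to_localInverse hLd (by simp)
  have hleft : ∀ᶠ x in 𝓝 p, (e.symm ∘ c.symm) ((c ∘ e) x) = x := by
    have h2 : ∀ᶠ x in 𝓝 p, e x ∈ c.source :=
      (hf p hp).continuousAt.preimage_mem_nhds (extChartAt_source_mem_nhds (I := 𝓡 3) (e p))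
    have h3 : ∀ᶠ x in 𝓝 p, x ∈ e.source := e.open_source.mem_nhds hp
    filter_upwards [h2, h3] with x hx hx'
    show e.symm (c.symm (c (e x))) = x
    rw [c.left_inv hx, e.left_inv hx']
  have h4 : ∀ᶠ z in 𝓝 ((c ∘ e) p), (e.symm ∘ c.symm) z = hG.localInverse hLd (by simp) z :=
    hS.localInverse_unique hleft
  have h5 : ContDiffAt ℝ ∞ (e.symm ∘ c.symm) ((c ∘ e) p) := h1.congr_of_eventuallyEq h4
  -- back to the manifold: `e.symm = (e.symm ∘ c.symm) ∘ c` near `y = e p`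
  have h6 : ContMDiffAt (𝓡 3) 𝓘(ℝ, ℝ × ℝ × ℝ) ∞ ((e.symm ∘ c.symm) ∘ c) (e p) :=
    h5.contMDiffAt.comp (e p) (contMDiffAt_extChartAt (I := 𝓡 3) (x := e p))
  have h7 : e.symm =ᶠ[𝓝 (e p)] ((e.symm ∘ c.symm) ∘ c) := by
    filter_upwards [extChartAt_source_mem_nhds (I := 𝓡 3) (e p)] with z hz
    show e.symm z = e.symm (c.symm (c z))
    rw [c.left_inv hz]
  rw [← hyp]
  exact h6.congr_of_eventuallyEq h7

end ChartOpen

end Summit.SmoothPoincare4.SmoothPoincare4.Theorems.AcyclicBisectionExists.ModpBraidOrbits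

end
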